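import Mathlib
import HarnessLib
import Summits.HubbardSuperconductivity.HubbardSuperconductivity.Theorems.KLProgrammeKLRegimeEngineIsoTupleSmallness
import Summits.HubbardSuperconductivity.HubbardSuperconductivity.Theorems.KLProgrammeKLRegimeEngineV8DefsU10
import Summits.HubbardSuperconductivity.HubbardSuperconductivity.Theorems.KLProgrammeKLRegimeEngineV8DefsL4
import Summits.HubbardSuperconductivity.HubbardSuperconductivity.Theorems.KLProgrammeKLRegimeEngineV8Raise

/-!
# Route `KLProgramme` — ENGINE child gen 8 (stmt-HubbardSuperconductivity-20437 `KLRegimeEngineV17F2`), stub (c) `stub_engine_step_values`, (E5-F)ₙ input (III)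
# at the v2 TOKENS: the rows-smallness line CLOSED under `U ≤ klEngU₀10 P R c` (token #14) and `klEngL₄ P R β U ≤ L` (token #16) at `(klEngGeo8, klEngQ8 P R)`
# (cell gate-hubbard-kl, seat hubbard-kl-k3c2-p2 g9, value/(T) lane; v2 re-key of `rowsSmallness_klEng7Q7_of_doors`, …EngineIsoTupleSmallness)

(III) of the (E5-F)ₙ door is `rowsSmallness_of_doors` (…EngineIsoTupleSmallness): a U-door `U·D(G,P,Q) ≤ 1/4` and a volume line
`Σ_{j<n} Q.CL β j/L ≤ U/4`.  At the v2 tokens both are DISCHARGED by the registered thresholds: the U-door is entry 7 `klE5RowsU` of `klEngU₀10`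
(`rowsSmallness_hD_of_le_klEngU₀10`, …DefsU10), the volume line is `sum_CL_klEngQ7_div_le` under `klEngL4Real ≤ L` (`klEngL4Real_le_of_klEngL₄_le`, …DefsL4;
`(klEngQ8 P R).CL = (klEngQ7 P R).CL` by `rfl`), and `U ≤ 1` by `klEngU₀10 ≤ klEngU₀3`.  So:

* **`sum_CL_klEngQ8_div_le_of_klEngL₄_le`** — `Σ_{j<n} (klEngQ8 P R).CL β j / L ≤ U/4` for `n ≤ nScales β + 1`, `klEngL₄ P R β U ≤ L`;
* **`rowsSmallness_klEng8Q8_of_klEngU₀10`** — (III) at `(klEngGeo8, P, klEngQ8 P R)` with NO residual hypothesis beyond the stub binders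
  (`P.WF`, `klBetaMin ≤ β`, `0 < U ≤ klEngU₀10 P R c`, `n ≤ nScales β + 1`, `klEngL₄ P R β U ≤ L`);
* §2 (appended, plan g19 (R57b)(ii)) the RAISE-GENERIC form **`rowsSmallness_of_klEngU₀10_isRaiseOf`** at any `Q` with `(klEngQ8 P R).IsRaiseOf Q`,
  `Q.CR = (klEngQ8 P R).CR` (table B′'s CE-raise `klEngQ9`), via `klE5RowsD_eq_of_CR_eq` and `sum_CL_div_le_of_isRaiseOf_klEngQ8`.

Arithmetic only; nothing about the model is asserted; nothing asserts superconductivity.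
-/

noncomputable section

namespace Summit.HubbardSuperconductivity.HubbardSuperconductivity.Theorems.KLRegimeSplit

set_option linter.dupNamespace false -- summit = problem name (single-conjunct summit), D-0017

open Real Finset Literature.MathematicalPhysics.QuantumLattice Literature.Probability.LatticeModels
open Summit.HubbardSuperconductivity.HubbardSuperconductivity.Theorems.KLProgrammeLegKernels
open Summit.HubbardSuperconductivity.HubbardSuperconductivity.Theorems.EngineV8

/-- **The volume line at the v2 tokens**: `Σ_{j<n} (klEngQ8 P R).CL β j / L ≤ U/4` for `n ≤ nScales β + 1` and `klEngL₄ P R β U ≤ L`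
(`(klEngQ8).CL = (klEngQ7).CL`, `sum_CL_klEngQ7_div_le`, `klEngL4Real_le_of_klEngL₄_le`). -/
theorem sum_CL_klEngQ8_div_le_of_klEngL₄_le (P : SplitConsts) (R : RenConsts) {β U : ℝ} (hβ : klBetaMin ≤ β) (hU : 0 < U) {n L : ℕ}
    (hn : n ≤ nScales β + 1) (hL : klEngL₄ P R β U ≤ L) :
    ∑ j ∈ range n, (klEngQ8 P R).CL β j / (L : ℝ) ≤ U / 4 := by
  have h := sum_CL_klEngQ7_div_le P R hβ hU hn (L := L) (klEngL4Real_le_of_klEngL₄_le hL)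
  simpa only [klEngQ8_CL_apply] using h

/-- **(E5-F)ₙ input (III) CLOSED at the v2 tokens** `(klEngGeo8, klEngQ8 P R, klEngU₀10, klEngL₄)`: the rows-smallness line of `rowsSmallness_of_doors`
with the U-door discharged by `klEngU₀10 ≤ klE5RowsU` and the volume line by `klEngL₄ ≤ L` — no residual hypothesis beyond the stub binders. -/
theorem rowsSmallness_klEng8Q8_of_klEngU₀10 (P : SplitConsts) (R : RenConsts) (hP : P.WF) {c β U : ℝ} (hβ : klBetaMin ≤ β) (hU : 0 < U)
    (hU10 : U ≤ klEngU₀10 P R c) {n L : ℕ} (hn : n ≤ nScales β + 1) (hL : klEngL₄ P R β U ≤ L) :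
    initDevBar klEngGeo8 U + legDressBarQ2 klEngGeo8 P (klEngQ8 P R) U 0 4 +
        (3 * klEngGeo8.CF * (P.Klam * U) ^ 2 +
          ((klEngGeo8.cloc * P.Klam ^ 2 * (1 - (4 : ℝ) ^ (-klEngGeo8.θ))⁻¹ + 2 * (klEngQ8 P R).CR * P.Klam ^ 3 * |U|) * U ^ 2 +
              ∑ j ∈ range n, (klEngQ8 P R).CL β j / L) +
            7 / 3 * (klEngGeo8.CF * (P.Klam * U) ^ 2) + 20 * ((klEngQ8 P R).CR * ((P.Klam * U) ^ 2 + (P.Klam * |U|) ^ 3)) +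
              4 / 3 * ((klEngQ8 P R).CR * (P.Klam * U) ^ 2)) ≤ U / 2 :=
  rowsSmallness_of_doors klEngGeo8_wf hP (klEngQ8_wf P R) hU (le_one_of_le_klEngU₀3 (hU10.trans (klEngU₀10_le_klEngU₀3 P R c)))
    (rowsSmallness_hD_of_le_klEngU₀10 hU hU10) (sum_CL_klEngQ8_div_le_of_klEngL₄_le P R hβ hU hn hL)

/-! ## §2 (appended) RAISE-GENERIC form (plan g19 (R57b)(ii)): any CE-raise `Q` of `klEngQ8 P R` (same `CR`; e.g. table B′'s `klEngQ9`) -/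

/-- `klE5RowsD` reads the engine package only through `CR`: a raise of `klEngQ8 P R` with the same `CR` has the same coefficient. -/
theorem klE5RowsD_eq_of_CR_eq {P : SplitConsts} {R : RenConsts} {Q : EngConsts} (hCR : Q.CR = (klEngQ8 P R).CR) :
    klE5RowsD klEngGeo8 P Q = klE5RowsD klEngGeo8 P (klEngQ8 P R) := by
  rw [klE5RowsD_eq, klE5RowsD_eq, hCR]

/-- **The volume line at a raise `Q` of `klEngQ8 P R`** (`Q.CL = (klEngQ8 P R).CL` by `IsRaiseOf.CL_eq`): `Σ_{j<n} Q.CL β j / L ≤ U/4`. -/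
theorem sum_CL_div_le_of_isRaiseOf_klEngQ8 (P : SplitConsts) (R : RenConsts) {Q : EngConsts} (hQ : (klEngQ8 P R).IsRaiseOf Q) {β U : ℝ}
    (hβ : klBetaMin ≤ β) (hU : 0 < U) {n L : ℕ} (hn : n ≤ nScales β + 1) (hL : klEngL₄ P R β U ≤ L) :
    ∑ j ∈ range n, Q.CL β j / (L : ℝ) ≤ U / 4 := by
  rw [hQ.CL_eq]
  exact sum_CL_klEngQ8_div_le_of_klEngL₄_le P R hβ hU hn hL

/-- **(E5-F)ₙ input (III) at ANY CE-raise `Q` of `klEngQ8 P R`** (`(klEngQ8 P R).IsRaiseOf Q`, `Q.CR = (klEngQ8 P R).CR` — table B′'s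
`klEngQ9 P R := (klEngQ8 P R).withCE _` qualifies with `rfl`): the rows-smallness line at `(klEngGeo8, P, Q)` under `0 < U ≤ klEngU₀10 P R c`,
`n ≤ nScales β + 1`, `klEngL₄ P R β U ≤ L` — raise-generic per (R57b)(ii), so the FREEZE line's `QT` instantiates it with no CR/CE transfer. -/
theorem rowsSmallness_of_klEngU₀10_isRaiseOf (P : SplitConsts) (R : RenConsts) (hP : P.WF) {Q : EngConsts} (hQ : (klEngQ8 P R).IsRaiseOf Q)
    (hCR : Q.CR = (klEngQ8 P R).CR) {c β U : ℝ} (hβ : klBetaMin ≤ β) (hU : 0 < U) (hU10 : U ≤ klEngU₀10 P R c) {n L : ℕ}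
    (hn : n ≤ nScales β + 1) (hL : klEngL₄ P R β U ≤ L) :
    initDevBar klEngGeo8 U + legDressBarQ2 klEngGeo8 P Q U 0 4 +
        (3 * klEngGeo8.CF * (P.Klam * U) ^ 2 +
          ((klEngGeo8.cloc * P.Klam ^ 2 * (1 - (4 : ℝ) ^ (-klEngGeo8.θ))⁻¹ + 2 * Q.CR * P.Klam ^ 3 * |U|) * U ^ 2 +
              ∑ j ∈ range n, Q.CL β j / L) +
            7 / 3 * (klEngGeo8.CF * (P.Klam * U) ^ 2) + 20 * (Q.CR * ((P.Klam * U) ^ 2 + (P.Klam * |U|) ^ 3)) +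
              4 / 3 * (Q.CR * (P.Klam * U) ^ 2)) ≤ U / 2 := by
  have hD : U * ((∑ χ, (klEngGeo8.abot χ + klEngGeo8.atop χ) + 1) + 24 * Q.CR * (P.Klam ^ 2 + P.Klam ^ 3) +
        16 / 3 * klEngGeo8.CF * P.Klam ^ 2 + klEngGeo8.cloc * P.Klam ^ 2 * (1 - (4 : ℝ) ^ (-klEngGeo8.θ))⁻¹ +
          2 * Q.CR * P.Klam ^ 3 + 4 / 3 * Q.CR * P.Klam ^ 2) ≤ 1 / 4 := by
    have h := mul_klE5RowsD_le_quarter_of_le_klEngU₀10 hU hU10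
    rw [← klE5RowsD_eq_of_CR_eq hCR, klE5RowsD_eq] at h
    exact h
  exact rowsSmallness_of_doors klEngGeo8_wf hP (hQ.wf (klEngQ8_wf P R)) hU
    (le_one_of_le_klEngU₀3 (hU10.trans (klEngU₀10_le_klEngU₀3 P R c))) hD (sum_CL_div_le_of_isRaiseOf_klEngQ8 P R hQ hβ hU hn hL)

end Summit.HubbardSuperconductivity.HubbardSuperconductivity.Theorems.KLRegimeSplit

end
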